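import Summits.QuantumFields.GaugeBoot.Certificates.SparseReducedWindow
import Summits.QuantumFields.GaugeBoot.Certificates.KZL2rpD3b20LoDA
import HarnessLib

/-!
# Kernel replay of the certsdp certificate `kzL2_D3_b20_min_rp_G2` — part G: factor-row assembly and objective (gb_lean_emit_win 0.10.1)

HONEST FRAMING (cell `pub-gaugeboot`): certified bounds on lattice expectations at stated coupling,
gauge group, dimension and torus size; NOT a mass gap, NOT a continuum limit, NOT a string tension;
NOT Yang–Mills-summit-bearing (barriers `FixedCouplingUltralocality`, `PerturbativeInvisibility`).

Certificate sha256 `199fdb64ce5546af7d37e80ca76293b0502215d8dfa8ec6c1be05020aeb2fe7e` (problem `kzL2_D3_b20_min_rp_G2`, sha256 `c9fdb0a8f51ddfd8ade91552d8cf813e9696163e24e697cccc3350bad0c0aecc`): `GB` = all factor rows (data parts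
`Certificates/KZL2rpD3b20LoD….lean` concatenated), the INTEGER objective row `cZ`, the certified bound `lowerQ`, and the kernel check
`gb_len` (factor rows fit the padded dimension 38). Windows: `Certificates/KZL2rpD3b20LoA….lean`; assembly + theorems: `Certificates/KZL2rpD3b20Lo.lean`.
Data/plumbing only; nothing is claimed about lattice gauge theory in this file.
-/

namespace Summit.QuantumFields.GaugeBoot.Certificates.KZL2rpD3b20Lo

noncomputable section

open Summit.QuantumFields.GaugeBoot.Certificates.Sparse

/-- All factor rows (concatenation of the data parts' block lists). -/
def GB : List (List (List ℤ)) := GBa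

/-- Objective as a sparse INTEGER row: (1)·y_1. -/
def cZ : List (ℕ × ℤ) := [(1, 1)]

/-- The certified lower bound on the objective (exact): `418926054784685709207015781/453347182355485940514816000` (≈ 0.9240733616299). -/
def lowerQ : ℚ := 418926054784685709207015781/453347182355485940514816000

set_option maxHeartbeats 0 in
/-- Kernel check: every factor row of every block has length `≤ 38`. -/
theorem gb_len : lenCheckAll KZL2rpD3b20Lo.GB 38 40 = true := by
  decide +kernel

end

end Summit.QuantumFields.GaugeBoot.Certificates.KZL2rpD3b20Lo
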